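import Mathlib.MeasureTheory.Function.LpSpace.Basic
import Mathlib.MeasureTheory.Measure.Lebesgue.EqHaar
import Mathlib.MeasureTheory.Measure.Haar.InnerProductSpace
import Mathlib.Analysis.InnerProductSpace.PiL2
import HarnessLib

/-!
# Dilation operators `f ↦ f(a ·)` on `L^p(V)` (the `L^p` scaling identity)

Analysis/OperatorTheory support file (one definition with body, everything proved, no named
facts): for a finite-dimensional real inner product space `V` (Lebesgue measure), a complex
normed space `F` of values, `1 ≤ p < ∞` and `a ≠ 0`, the dilation `(D_a f)(x) = f(a x)` is a
bounded operator on `L^p(V; F)` with the exact scaling law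

  `‖D_a f‖_p = |a|^{−d/p} ‖f‖_p`,   `d = dim V`

(change of variables `y = a x`, `dy = |a|^d dx`; Stein–Weiss, *Fourier Analysis on Euclidean
Spaces*, Ch. I §1; Lieb–Loss, *Analysis*, §2.? scaling). Mathlib ingredients:
`Measure.map_addHaar_smul` (`(a ·)_* dx = |a^d|⁻¹ dx`), `eLpNorm_map_measure`,
`eLpNorm_smul_measure_of_ne_top`.

* `eLpNorm_comp_smul`, `memLp_comp_smul`: the scaling identity and `L^p`-membership;
* `lpDilation a ha hp : Lp F p →L[ℂ] Lp F p` (**definition**), `lpDilation_coeFn`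
  (`D_a f = f(a ·)` a.e.), `norm_lpDilation_apply` (the scaling law), `lpDilation_one`,
  `lpDilation_mul` (`D_a D_b = D_{ba}`).

This is step (i) of the Fourier-side construction of the similarity heat semigroup
`e^{τ(Δ + ½x·∇ + ½)}` (Jia–Šverák 2015, Lemma 2.1; Albritton–Brué–Colombo 2022, §2) as an
explicit weighted dilation semigroup on `L²`.

## References

* E. M. Stein, G. Weiss, *Introduction to Fourier Analysis on Euclidean Spaces* (1971), Ch. I §1
  (dilations and the `L^p` scaling identity). [SteinWeiss1971]
-/

noncomputable section

open MeasureTheory Filter Topology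
open scoped ENNReal NNReal

namespace Literature.Analysis.OperatorTheory

variable {V : Type*} [NormedAddCommGroup V] [InnerProductSpace ℝ V] [FiniteDimensional ℝ V]
  [MeasurableSpace V] [BorelSpace V]
variable {F : Type*} [NormedAddCommGroup F]
variable {p : ℝ≥0∞}

/-- The Jacobian factor of the dilation `x ↦ a x`: `(a ·)_* dx = |a^d|⁻¹ • dx`. [folklore] -/
theorem map_volume_smul {a : ℝ} (ha : a ≠ 0) :
    Measure.map (fun x : V => a • x) (volume : Measure V) =
      ENNReal.ofReal |(a ^ Module.finrank ℝ V)⁻¹| • (volume : Measure V) :=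
  Measure.map_addHaar_smul volume ha

/-- `x ↦ a x` is quasi-measure-preserving for Lebesgue measure (`a ≠ 0`). [folklore] -/
theorem quasiMeasurePreserving_smul' {a : ℝ} (ha : a ≠ 0) :
    Measure.QuasiMeasurePreserving (fun x : V => a • x) (volume : Measure V) volume :=
  Measure.quasiMeasurePreserving_smul volume ha

/-- **The `L^p` scaling identity**: `‖g(a ·)‖_p = |a^d|^{−1/p} ‖g‖_p` (`p < ∞`).
[cite: SteinWeiss1971, Ch. I §1] -/
theorem eLpNorm_comp_smul {g : V → F} (hg : AEStronglyMeasurable g (volume : Measure V)) {a : ℝ}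
    (ha : a ≠ 0) (hp : p ≠ ∞) :
    eLpNorm (fun x => g (a • x)) p (volume : Measure V) =
      ENNReal.ofReal |(a ^ Module.finrank ℝ V)⁻¹| ^ (1 / p).toReal * eLpNorm g p volume := by
  have hg' : AEStronglyMeasurable g (Measure.map (fun x : V => a • x) volume) := by
    rw [map_volume_smul ha]
    exact hg.smul_measure _
  have h := eLpNorm_map_measure (p := p) hg' (measurable_const_smul a).aemeasurable
  rw [map_volume_smul ha, eLpNorm_smul_measure_of_ne_top hp, smul_eq_mul] at h
  exact h.symm

/-- `g ∈ L^p ⇒ g(a ·) ∈ L^p`. [cite: SteinWeiss1971, Ch. I §1] -/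
theorem memLp_comp_smul {g : V → F} (hg : MemLp g p (volume : Measure V)) {a : ℝ} (ha : a ≠ 0) :
    MemLp (fun x => g (a • x)) p (volume : Measure V) := by
  have hg' : MemLp g p (Measure.map (fun x : V => a • x) volume) := by
    rw [map_volume_smul ha]
    exact hg.smul_measure ENNReal.ofReal_ne_top
  exact hg'.comp_of_map (measurable_const_smul a).aemeasurable

/-- Transport of a.e. equalities along the dilation. [folklore] -/
theorem ae_eq_comp_smul {β : Type*} {g g' : V → β} (h : g =ᵐ[(volume : Measure V)] g') {a : ℝ}
    (ha : a ≠ 0) : (fun x => g (a • x)) =ᵐ[(volume : Measure V)] fun x => g' (a • x) :=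
  (quasiMeasurePreserving_smul' ha).ae_eq h

variable [NormedSpace ℂ F] [Fact (1 ≤ p)]

/-- **The dilation operator `D_a f = f(a ·)` on `L^p(V; F)`**, `a ≠ 0`, `1 ≤ p < ∞`, as a bounded
operator. [cite: SteinWeiss1971, Ch. I §1] -/
def lpDilation (a : ℝ) (ha : a ≠ 0) (hp : p ≠ ∞) :
    Lp F p (volume : Measure V) →L[ℂ] Lp F p (volume : Measure V) :=
  LinearMap.mkContinuous
    { toFun := fun f => (memLp_comp_smul (Lp.memLp f) ha).toLp _
      map_add' := fun f g => by
        apply Lp.ext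
        refine (MemLp.coeFn_toLp _).trans ?_
        refine (ae_eq_comp_smul (Lp.coeFn_add f g) ha).trans ?_
        refine EventuallyEq.trans ?_ (Lp.coeFn_add _ _).symm
        filter_upwards [MemLp.coeFn_toLp (memLp_comp_smul (Lp.memLp f) ha),
          MemLp.coeFn_toLp (memLp_comp_smul (Lp.memLp g) ha)] with x hx hy
        simp only [Pi.add_apply, hx, hy]
      map_smul' := fun c f => by
        apply Lp.ext
        refine (MemLp.coeFn_toLp _).trans ?_
        refine (ae_eq_comp_smul (Lp.coeFn_smul c f) ha).trans ?_
        refine EventuallyEq.trans ?_ (Lp.coeFn_smul _ _).symm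
        filter_upwards [MemLp.coeFn_toLp (memLp_comp_smul (Lp.memLp f) ha)] with x hx
        simp only [Pi.smul_apply, hx, RingHom.id_apply] }
    ((ENNReal.ofReal |(a ^ Module.finrank ℝ V)⁻¹| ^ (1 / p).toReal).toReal)
    (fun f => by
      simp only [LinearMap.coe_mk, AddHom.coe_mk, Lp.norm_toLp]
      rw [eLpNorm_comp_smul (Lp.memLp f).aestronglyMeasurable ha hp, ENNReal.toReal_mul,
        Lp.norm_def])

/-- `D_a f = f(a ·)` almost everywhere. [cite: SteinWeiss1971, Ch. I §1] -/
theorem lpDilation_coeFn {a : ℝ} (ha : a ≠ 0) (hp : p ≠ ∞) (f : Lp F p (volume : Measure V)) :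
    (lpDilation a ha hp f : V → F) =ᵐ[(volume : Measure V)] fun x => f (a • x) :=
  MemLp.coeFn_toLp (memLp_comp_smul (Lp.memLp f) ha)

/-- **The scaling law `‖D_a f‖_p = |a^d|^{−1/p} ‖f‖_p`.** [cite: SteinWeiss1971, Ch. I §1] -/
theorem norm_lpDilation_apply {a : ℝ} (ha : a ≠ 0) (hp : p ≠ ∞) (f : Lp F p (volume : Measure V)) :
    ‖lpDilation a ha hp f‖ =
      (ENNReal.ofReal |(a ^ Module.finrank ℝ V)⁻¹| ^ (1 / p).toReal).toReal * ‖f‖ := by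
  rw [Lp.norm_def, Lp.norm_def, ← ENNReal.toReal_mul,
    ← eLpNorm_comp_smul (Lp.memLp f).aestronglyMeasurable ha hp]
  exact congrArg ENNReal.toReal (eLpNorm_congr_ae (lpDilation_coeFn ha hp f))

/-- `D_1 = 1`. [folklore] -/
theorem lpDilation_one (hp : p ≠ ∞) :
    (lpDilation 1 one_ne_zero hp : Lp F p (volume : Measure V) →L[ℂ] Lp F p (volume : Measure V)) =
      1 := by
  ext1 f
  apply Lp.ext
  refine (lpDilation_coeFn one_ne_zero hp f).trans ?_
  exact Eventually.of_forall fun x => by simp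

/-- **`D_a D_b = D_{ba}`** (`(D_a (D_b f))(x) = f(b (a x)) = f((b a) x)`). [folklore] -/
theorem lpDilation_mul {a b : ℝ} (ha : a ≠ 0) (hb : b ≠ 0) (hp : p ≠ ∞) :
    (lpDilation a ha hp * lpDilation b hb hp :
        Lp F p (volume : Measure V) →L[ℂ] Lp F p (volume : Measure V)) =
      lpDilation (b * a) (mul_ne_zero hb ha) hp := by
  ext1 f
  apply Lp.ext
  rw [mul_apply_eq_comp]
  refine (lpDilation_coeFn ha hp _).trans ?_
  refine (ae_eq_comp_smul (lpDilation_coeFn hb hp f) ha).trans ?_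
  refine EventuallyEq.trans (Eventually.of_forall fun x => ?_) (lpDilation_coeFn _ hp f).symm
  simp only [smul_smul]

end Literature.Analysis.OperatorTheory
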